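import Summits.AtomisticToContinuum.Crystallization.Theorems.GrainCoreNetworkSplitMuEquilibriumDoor
import Summits.AtomisticToContinuum.Crystallization.Theorems.ChartedPlanarOrderDoorAssembly
import Summits.AtomisticToContinuum.Crystallization.Theorems.ChartedPlanarOrderMesoCutDoor

/-!
# N 26636 with the door DISCHARGED: GAP(1/50) ∧ PERT(1/50) ⟸ BULK alone (or HBG♮ ∧ RED♮, or R⋆)

decomp-a2c · N `stmt-AtomisticToContinuum-26636` · terminal by-name leaf (hand-1 g8), after item `stmt-AtomisticToContinuum-27073`
`MuEquilibriumDoor` was CLOSED (proved) by `GrainCoreNetworkSplitMuEquilibriumDoor.muEquilibriumDoor` (p816834; the EquilibriumInLaw chain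
rebuilt on the farm 2026-08-31T08:22Z).  Every door hypothesis of the `RigidityDoor` / `DensityDichotomy` / `MesoCut` kernels is now a
tree theorem — `MuEquilibriumDoor` (p816834), `SparseNull ν ∀ν` (p815496), `WindowCounting` (p813143), `BindingSurface` (p816066), Floor♭
(p814364) — so the residual of record on N reads, BY NAME and without hypotheses other than the bottleneck itself:

* `gap_and_pert_1_50_of_bulk_discharged`      : `BulkDefectGap → VisibleGap (1/50) ∧ PertRegime (1/50)`;
* `gap_and_pert_1_50_of_rigidity_discharged`  : `DiscreteBarlowRigidity → VisibleGap (1/50) ∧ PertRegime (1/50)` (R⋆, stmt-28120);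
* `gap_and_pert_1_50_of_bulkDoor_discharged`  : `MesoCut.BulkDefectGapDoor → …`;
* `gap_and_pert_1_50_of_meso_discharged`      : `MesoCut.NearHomBulkGap → MesoCut.MesoHomogenisation → …` (lens-3 HBG♮ ∧ RED♮);
* `visibleGap_of_sparseMisfit`, `pertRegime_of_sparseMisfit` : D♯ alone gives GAP / PERT.

(The module imports the `MuGSC.lean` side of Literature through the closer; it co-imports with the `RigidityDoor` family — checked — but NOT with
modules importing `Literature…MuGroundStateConfiguration` (duplicate `UniformlyDiscrete`), e.g. the `FrustratedLawDichotomy…Door` files of the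
Φaper line, whose `hDoor` binders therefore stay until that Literature duplicate is resolved.)  DEF-FREE; axioms standard.
-/

noncomputable section

namespace Summit.AtomisticToContinuum.Crystallization.Theorems.ChartedPlanarOrderDoorDischarged

open Summit.AtomisticToContinuum.Crystallization.Theorems.ChartedPlanarOrderRigidityDoor
open Summit.AtomisticToContinuum.Crystallization.Theorems.ChartedPlanarOrderDensityDichotomy
open Summit.AtomisticToContinuum.Crystallization.Theorems.GrainCoreNetworkSplitMuEquilibriumDoor (muEquilibriumDoor)

/-- **BULK ⟹ GAP(1/50) ∧ PERT(1/50)**, all door inputs discharged by name. [this work] -/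
theorem gap_and_pert_1_50_of_bulk_discharged (hBu : BulkDefectGap) : VisibleGap (1 / 50) ∧ PertRegime (1 / 50) :=
  ChartedPlanarOrderDoorAssembly.gap_and_pert_1_50_of_door_bulk muEquilibriumDoor hBu

/-- **R⋆ ⟹ GAP(1/50) ∧ PERT(1/50)** (`DiscreteBarlowRigidity`, stmt-AtomisticToContinuum-28120), all door inputs discharged. [this work] -/
theorem gap_and_pert_1_50_of_rigidity_discharged (hR : DiscreteBarlowRigidity) : VisibleGap (1 / 50) ∧ PertRegime (1 / 50) :=
  ChartedPlanarOrderDoorAssembly.gap_and_pert_1_50_of_door_rigidity muEquilibriumDoor hR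

/-- **BULK|door ⟹ GAP(1/50) ∧ PERT(1/50)** (lens-3 MesoCut's door-restricted BULK), all door inputs discharged. [this work] -/
theorem gap_and_pert_1_50_of_bulkDoor_discharged (hBu : ChartedPlanarOrderMesoCut.BulkDefectGapDoor) :
    VisibleGap (1 / 50) ∧ PertRegime (1 / 50) :=
  ChartedPlanarOrderMesoCut.gap_and_pert_1_50_of_bulkDoor_final muEquilibriumDoor hBu

/-- **HBG♮ ∧ RED♮ ⟹ GAP(1/50) ∧ PERT(1/50)** (lens-3 MesoCut v2), all door inputs discharged. [this work] -/
theorem gap_and_pert_1_50_of_meso_discharged (hG : ChartedPlanarOrderMesoCut.NearHomBulkGap)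
    (hM : ChartedPlanarOrderMesoCut.MesoHomogenisation) : VisibleGap (1 / 50) ∧ PertRegime (1 / 50) :=
  ChartedPlanarOrderMesoCut.gap_and_pert_1_50_of_meso_final muEquilibriumDoor hG hM

/-- **D♯(ν) ⟹ GAP(ν)** for every `ν` (door and SparseNull discharged). [this work] -/
theorem visibleGap_of_sparseMisfit (ν : ℝ) (hS : SparseMisfit ν) : VisibleGap ν :=
  ChartedPlanarOrderDoorAssembly.visibleGap_of_door_sparseMisfit ν muEquilibriumDoor hS

/-- **D♯(≤ 1/16) ⟹ PERT(ν)** (door and SparseNull discharged). [this work] -/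
theorem pertRegime_of_sparseMisfit (ν : ℝ) (hS : ∀ η : ℝ, 0 < η → η ≤ 1 / 16 → SparseMisfit η) : PertRegime ν :=
  ChartedPlanarOrderDoorAssembly.pertRegime_of_door_sparseMisfit ν muEquilibriumDoor hS

end Summit.AtomisticToContinuum.Crystallization.Theorems.ChartedPlanarOrderDoorDischarged

end
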